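import Summits.BirchSwinnertonDyer.BirchSwinnertonDyer.Theorems.ManinLocalTwoThreeIstarTwoJValuation
import HarnessLib

/-!
# Additive reduction at `2` forces `ord₂ c₄ ≥ 4` on the minimal model: `ord₂ j + ord₂ Δ_min ≥ 12`

Summit `BirchSwinnertonDyer`, route `ManinLocalTwoThree` (cell bsd-f2-manin), cruxes C2 `ManinOddAtFour` (stmt-BirchSwinnertonDyer-22967) and
C3 `ManinPrimeToThreeAtNine` (stmt-…-22968).  A one-line observation on Tate's algorithm at a place where `2` is a uniformiser (`ℤ₂`), used by
the clock law at `2` (E-an-119, clauses `K ∈ {0, 12}`) and by an's S-an-47 (`PotOrdinaryAdditiveShapeTwo`): after Step 2 (`π ∣ a₃, a₄, a₆`)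
additivity means `b₂ = a₁² + 4a₂ ∈ 𝔪`, so `a₁ = 2α`, and then `c₄ = b₂² − 24b₄ = 16((α² + a₂)² − 6(αγ + q))` (`a₃ = 2γ`, `a₄ = 2q`):
**`2⁴ ∣ c₄`** (`two_pow_four_dvd_c₄_of_additive`).  Over `ℚ` (`j·Δ_min = c₄³`):

* `twelve_le_padicValRat_two_j_add_ordMinimalDiscriminant` — additive at `2`, `j ≠ 0` ⟹ `ord₂ j + ord₂ Δ_min ≥ 12`;
* `padicValRat_two_j_pos_of_additive_of_ordMinimalDiscriminant_le` — additive at `2` with `ord₂ Δ_min ≤ 11` ⟹ `j = 0 ∨ ord₂ j ≥ 1`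
  (so the types `II, III, IV, I₀*, IV*` at `2` — `ord₂ Δ_min ≤ 10` by the tree's `…KodairaDiscriminantValuesTwoProofs` — are potentially
  SUPERSINGULAR);
* `twelve_le_ordMinimalDiscriminant_of_potOrdinary_additive_two` — a potentially ORDINARY additive fibre at `2` (`ord₂ j = 0`) has
  `ord₂ Δ_min ≥ 12`; with `f₂ ≤ 8` and `m₂ ≤ 13` (`…IstarTwoJValuation`): `12 ≤ ord₂ Δ_min ≤ 20`.

HONEST FRAMING: local structure; C2, C3, Manin's conjecture and BSD are not proved.  No definitions, no named facts, no sorry.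
References: [SilvermanATAEC1994] IV.9.4 Steps 2–3; [SilvermanAEC2009] VII.5.1.
-/

set_option linter.dupNamespace false
set_option autoImplicit false

noncomputable section

open scoped Classical

open WeierstrassCurve IsDedekindDomain IsLocalRing
  Literature.NumberTheory.DiophantineGeometry Literature.NumberTheory.DiophantineGeometry.TateAlgorithm
  Literature.NumberTheory.DiophantineGeometry.TateAlgorithm.CharTwo
  Literature.NumberTheory.EllipticCurves
open IsDiscreteValuationRing hiding maximalIdeal

namespace Summit.BirchSwinnertonDyer.BirchSwinnertonDyer.Theorems.ManinLocalTwoThree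

/-! ### §1 Local: `2⁴ ∣ c₄` for additive reduction when `2` is a uniformiser -/

section DVR

variable {R : Type*} [CommRing R] [IsDomain R] [IsDiscreteValuationRing R]

/-- **Additive reduction, `2` a uniformiser ⟹ `2⁴ ∣ c₄`:** on the Step-2 model `a₁ = 2α`, `a₃ = 2γ`, `a₄ = 2q` and
`c₄ = 16((α² + a₂)² − 6(αγ + q))`. [cite: SilvermanATAEC1994, IV.9.4 Steps 2–3] -/
theorem two_pow_four_dvd_c₄_of_additive [PerfectField (ResidueField R)] (h2 : Irreducible (2 : R)) (W : WeierstrassCurve R)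
    (hΔ : W.Δ ∈ maximalIdeal R) (hc₄ : W.c₄ ∈ maximalIdeal R) : (2 : R) ^ 4 ∣ W.c₄ := by
  have h2m₁ : ∀ {x : R}, x ∈ maximalIdeal R ↔ (2 : R) ∣ x := fun {x} => mem_maximalIdeal_iff_dvd_of_irreducible h2 x
  obtain ⟨C, hu, hA₃, hA₄, hA₆⟩ := exists_variableChange_step2_of_perfectField W hΔ
  set W₂ := C • W with hW₂
  have hc : W₂.c₄ = W.c₄ := c₄_smul_of_u_eq_one hu W
  have hb₂ : W₂.b₂ ∈ maximalIdeal R := OggBound.b₂_mem_of_c₄_mem hA₃ hA₄ (hc ▸ hc₄)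
  obtain ⟨α, hα⟩ := two_dvd_a₁_of_two_dvd_b₂ h2 W₂ (h2m₁.mp hb₂)
  obtain ⟨γ, hγ⟩ := h2m₁.mp hA₃
  obtain ⟨q, hq⟩ := h2m₁.mp hA₄
  rw [← hc]
  refine ⟨(α ^ 2 + W₂.a₂) ^ 2 - 6 * (α * γ + q), ?_⟩
  simp only [WeierstrassCurve.c₄, WeierstrassCurve.b₂, WeierstrassCurve.b₄, hα, hγ, hq]
  ring

end DVR

/-! ### §2 Over `ℚ` at `2` -/

section Rat

open NumberField Rat.HeightOneSpectrum Summit.BirchSwinnertonDyer.Rank1Residual.Additive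

/-- `j ≠ 0 ⟹ c₄ ≠ 0` on the integral local minimal model (`j · Δ(M) = c₄(M)³` in `K_v`). [folklore] -/
theorem localMinimalIntegralModel_c₄_ne_zero_of_j_ne_zero {A : Type*} [CommRing A] [IsDedekindDomain A] {K : Type*} [Field K]
    [Algebra A K] [IsFractionRing A K] (v : HeightOneSpectrum A) (W : WeierstrassCurve K) [W.IsElliptic] (hj : W.j ≠ 0) :
    (W.localMinimalIntegralModel v).c₄ ≠ 0 := by
  set O := v.adicCompletionIntegers K with hO
  set M := W.localMinimalIntegralModel v with hM
  have hΔ0 : M.Δ ≠ 0 := localMinimalIntegralModel_Δ_ne_zero v W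
  intro h0
  have hjΔ : ∀ (E : WeierstrassCurve (v.adicCompletion K)) [E.IsElliptic], E.j * E.Δ = E.c₄ ^ 3 := fun E _ ↦ by
    rw [WeierstrassCurve.j, ← coe_Δ', mul_comm, ← mul_assoc, Units.mul_inv, one_mul]
  haveI hXell : (W.baseChange (v.adicCompletion K)).IsElliptic := by unfold baseChange; infer_instance
  obtain ⟨C, hC⟩ : ∃ C : VariableChange (v.adicCompletion K),
      C • W.baseChange (v.adicCompletion K) = W.localMinimalModel v := ⟨_, rfl⟩
  have key : (W.j : v.adicCompletion K) * ((M.Δ : O) : v.adicCompletion K) = ((M.c₄ : O) : v.adicCompletion K) ^ 3 := by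
    have hj' : (C • W.baseChange (v.adicCompletion K)).j = (W.j : v.adicCompletion K) := by
      rw [variableChange_j]; exact W.map_j _
    have hΔ' : ((M.Δ : O) : v.adicCompletion K) = (C • W.baseChange (v.adicCompletion K)).Δ := by
      rw [hC, hM, localMinimalIntegralModel]; exact integralModel_Δ_eq (v.adicCompletionIntegers K) (W.localMinimalModel v)
    have hc₄' : ((M.c₄ : O) : v.adicCompletion K) = (C • W.baseChange (v.adicCompletion K)).c₄ := by
      rw [hC, hM, localMinimalIntegralModel]; exact integralModel_c₄_eq (v.adicCompletionIntegers K) (W.localMinimalModel v)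
    rw [hΔ', hc₄', ← hj']
    exact hjΔ _
  rw [h0] at key
  simp only [ZeroMemClass.coe_zero, ne_eq, OfNat.ofNat_ne_zero, not_false_eq_true, zero_pow, mul_eq_zero] at key
  rcases key with h | h
  · have hv : v.valuation K W.j = 0 := by rw [← HeightOneSpectrum.valuedAdicCompletion_eq_valuation', h, map_zero]
    exact hj ((Valuation.zero_iff _).mp hv)
  · exact hΔ0 (by exact_mod_cast h)

/-- **Additive at `2` ⟹ `ord₂ j + ord₂ Δ_min ≥ 12`** (`ord₂ c₄ ≥ 4` on the minimal model, `j·Δ_min = c₄³`).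
[cite: SilvermanATAEC1994, IV.9.4 Steps 2–3] [cite: SilvermanAEC2009, VII.5.1] -/
theorem twelve_le_padicValRat_two_j_add_ordMinimalDiscriminant (W : WeierstrassCurve ℚ) [W.IsElliptic]
    (hadd : W.HasAdditiveReductionAt (placeOf 2)) (hj : W.j ≠ 0) :
    12 ≤ padicValRat 2 W.j + W.ordMinimalDiscriminant (placeOf 2) := by
  haveI : PerfectField (IsLocalRing.ResidueField ((placeOf 2).adicCompletionIntegers ℚ)) := PerfectField.ofFinite
  have h2 := irreducible_two_adicCompletionIntegers_placeOf_two
  set M := W.localMinimalIntegralModel (placeOf 2) with hM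
  obtain ⟨hΔm, hc₄m⟩ := (hasAdditiveReductionAt_iff_mem (placeOf 2) W).mp hadd
  have h16 := two_pow_four_dvd_c₄_of_additive h2 M hΔm hc₄m
  have hc₄0 : M.c₄ ≠ 0 := localMinimalIntegralModel_c₄_ne_zero_of_j_ne_zero (placeOf 2) W hj
  have hk4 : 4 ≤ (addVal ((placeOf 2).adicCompletionIntegers ℚ) M.c₄).toNat := le_addVal_toNat_of_pow_dvd h2 hc₄0 h16
  have hval := valuation_j_eq_exp_of_addVal_c₄ (placeOf 2) W (k := (addVal ((placeOf 2).adicCompletionIntegers ℚ) M.c₄).toNat)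
    (by omega) rfl
  have hgen : natGenerator (placeOf 2) = 2 :=
    congrArg Subtype.val ((primesEquiv (R := ℤ)).apply_symm_apply ⟨2, Nat.prime_two⟩)
  rw [valuation_eq_exp_neg_padicValRat (placeOf 2) hj, hgen] at hval
  have := WithZero.exp_injective hval
  omega

/-- **Additive at `2` with `ord₂ Δ_min ≤ 11` ⟹ potentially supersingular** (`j = 0` or `ord₂ j ≥ 1`); in particular the types
`II, III, IV, I₀*, IV*` at `2` (`ord₂ Δ_min ≤ 10`) are potentially supersingular. [cite: SilvermanATAEC1994, IV.9.4 Table 4.1] -/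
theorem potSupersingular_of_additive_two_of_ordMinimalDiscriminant_le (W : WeierstrassCurve ℚ) [W.IsElliptic]
    (hadd : W.HasAdditiveReductionAt (placeOf 2)) (hδ : W.ordMinimalDiscriminant (placeOf 2) ≤ 11) :
    W.j = 0 ∨ 1 ≤ padicValRat 2 W.j := by
  by_cases hj : W.j = 0
  · exact Or.inl hj
  · right
    have := twelve_le_padicValRat_two_j_add_ordMinimalDiscriminant W hadd hj
    have hδ' : (W.ordMinimalDiscriminant (placeOf 2) : ℤ) ≤ 11 := by exact_mod_cast hδ
    linarith

/-- **A potentially ORDINARY additive fibre at `2` has `12 ≤ ord₂ Δ_min`.** [cite: SilvermanATAEC1994, IV.9.4 Table 4.1] -/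
theorem twelve_le_ordMinimalDiscriminant_of_potOrdinary_additive_two (W : WeierstrassCurve ℚ) [W.IsElliptic]
    (hadd : W.HasAdditiveReductionAt (placeOf 2)) (hj : W.j ≠ 0) (hj0 : padicValRat 2 W.j = 0) :
    12 ≤ W.ordMinimalDiscriminant (placeOf 2) := by
  have := twelve_le_padicValRat_two_j_add_ordMinimalDiscriminant W hadd hj
  rw [hj0, zero_add] at this
  exact_mod_cast this

/-- **A potentially ordinary additive fibre at `2` has `12 ≤ ord₂ Δ_min ≤ 20`** (upper bound: `f₂ ≤ 8` and `m₂ ≤ 13` on the potentially good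
locus, Ogg `ord₂ Δ_min = f₂ + m₂ − 1`). [cite: SilvermanATAEC1994, IV.10.4 and IV.11.1] -/
theorem ordMinimalDiscriminant_le_twenty_of_potGood_additive_two (W : WeierstrassCurve ℚ) [W.IsElliptic]
    (hadd : W.HasAdditiveReductionAt (placeOf 2)) (hj : 0 ≤ padicValRat 2 W.j) :
    W.ordMinimalDiscriminant (placeOf 2) ≤ 20 := by
  haveI : PerfectField (IsLocalRing.ResidueField ((placeOf 2).adicCompletionIntegers ℚ)) := PerfectField.ofFinite
  have hk : (W.kodairaSymbolAt (placeOf 2)).IsAdditive := (isAdditive_kodairaSymbolAt_iff_holds (placeOf 2) W).mpr hadd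
  have h13 := numComponents_le_thirteen_of_potGood_two W hk hj
  have hf8 : W.conductorExponent (placeOf 2) ≤ 8 := W.conductorExponent_le_eight_holds (placeOf 2)
  have hle : W.numComponentsAt (placeOf 2) ≤ W.ordMinimalDiscriminant (placeOf 2) + 1 := numComponentsAt_le_holds (placeOf 2) W
  unfold conductorExponent at hf8
  unfold numComponentsAt at hf8 hle
  omega

end Rat

end Summit.BirchSwinnertonDyer.BirchSwinnertonDyer.Theorems.ManinLocalTwoThree

end
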